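import Summits.AtomisticToContinuum.HydrodynamicLimit.Theorems.ImplosionDichotomyPolynomialCompressionShadowingDefsHigher

/-!
# Bookkeeping lemmas for the final assembly (closing of stub 4, part 7)

Helper file for the line `log-lipschitz-budget` of the crux `ImplosionDichotomy.PolynomialCompression`
(stmt-AtomisticToContinuum-12587), stub `stub_logBudgetShadowing`, blueprint §5 (the CLOSE). Small
lemmas that keep the assembly `stub_logBudgetShadowing_of_levels` readable: choice functions for the
reference envelopes `Cpoly, ppoly` and the statics constants `Cstat` (extended by `0`, made nonnegative),
the choice of the common law-of-state constant `cZ` and of the packing threshold `ηs`, the law-of-state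
bounds along a solution of small packing (`ShadowSetting`'s three bounds and `ShadowEosHigher`), the
conversion of the four normalised level bounds at a time `s` into `E_k(s) ≤ (σ³Q̂Y)²` and
`√(E₂ + E₃)(s) ≤ σ³Q_B X^{b_B}`, and STRONG ⇒ WEAK (`ShadowWeakBootstrap 1 ηs` and (B2)) on `[0, t]`.
-/

noncomputable section

namespace Summit.AtomisticToContinuum.HydrodynamicLimit.Theorems

open Set MeasureTheory
open Literature.MathematicalPhysics.KineticTheory Literature.Analysis.FunctionSpaces

/-! ### Choices of constants -/

/-- Choice of the reference envelopes `Cpoly n ≥ 0`, `ppoly n` (`n ≤ 6`; extended by `0`). [folklore] -/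
theorem lbClose_poly_choice :
    ∀ {T₁ : ℝ} {ρ₁ : ℝ → T3 → ℝ} {u₁ : ℝ → T3 → V3},
      (∀ n : ℕ, n ≤ 6 → ∃ Cn pn : ℝ, ∀ t ∈ Ico 0 T₁, ∀ y : EuclideanSpace ℝ (Fin 3),
        ‖iteratedFDeriv ℝ n (Torus.lift (ρ₁ t)) y‖ ≤ Cn * (T₁ - t) ^ (-pn) ∧
        ‖iteratedFDeriv ℝ n (Torus.lift (u₁ t)) y‖ ≤ Cn * (T₁ - t) ^ (-pn)) →
      ∃ Cpoly ppoly : ℕ → ℝ, (∀ n, 0 ≤ Cpoly n) ∧ ∀ n : ℕ, n ≤ 6 → ∀ t ∈ Ico 0 T₁,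
        ∀ y : EuclideanSpace ℝ (Fin 3),
          ‖iteratedFDeriv ℝ n (Torus.lift (ρ₁ t)) y‖ ≤ Cpoly n * (T₁ - t) ^ (-ppoly n) ∧
          ‖iteratedFDeriv ℝ n (Torus.lift (u₁ t)) y‖ ≤ Cpoly n * (T₁ - t) ^ (-ppoly n) := by
  intro T₁ ρ₁ u₁ hpoly
  classical
  choose Cf pf hCf using hpoly
  refine ⟨fun n => if h : n ≤ 6 then max (Cf n h) 0 else 0, fun n => if h : n ≤ 6 then pf n h else 0,
    fun n => ?_, fun n hn t ht y => ?_⟩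
  · dsimp only
    by_cases h : n ≤ 6
    · rw [dif_pos h]; exact le_max_right _ _
    · rw [dif_neg h]
  · simp only [dif_pos hn]
    have hl : 0 < T₁ - t := by linarith [ht.2]
    have hfac : 0 ≤ (T₁ - t) ^ (-pf n hn) := Real.rpow_nonneg hl.le _
    have hm : Cf n hn * (T₁ - t) ^ (-pf n hn) ≤ max (Cf n hn) 0 * (T₁ - t) ^ (-pf n hn) :=
      mul_le_mul_of_nonneg_right (le_max_left _ _) hfac
    exact ⟨(hCf n hn t ht y).1.trans hm, (hCf n hn t ht y).2.trans hm⟩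

/-- Choice of nonnegative statics constants `Cstat n`, and of their sum over `n ≤ 3`. [folklore] -/
theorem lbClose_stat_choice :
    ∀ {σ₁ : ℝ} {ρs : ℝ → T3 → ℝ} {β₀ : T3 → ℝ},
      (∀ n : ℕ, ∃ Cn : ℝ, ∀ σ : ℝ, 0 < σ → σ < σ₁ → ∀ y : EuclideanSpace ℝ (Fin 3),
        ‖iteratedFDeriv ℝ n (Torus.lift (fun x => ρs σ x - β₀ x)) y‖ ≤ Cn * σ ^ 3) →
      ∃ Cstat : ℕ → ℝ, (∀ n, 0 ≤ Cstat n) ∧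
        (∀ (n : ℕ) (σ : ℝ), 0 < σ → σ < σ₁ → ∀ y : EuclideanSpace ℝ (Fin 3),
          ‖iteratedFDeriv ℝ n (Torus.lift (fun x => ρs σ x - β₀ x)) y‖ ≤ Cstat n * σ ^ 3) ∧
        ∀ n : ℕ, n ≤ 3 → Cstat n ≤ Cstat 0 + Cstat 1 + Cstat 2 + Cstat 3 := by
  intro σ₁ ρs β₀ hrate
  choose Cs hCs using hrate
  refine ⟨fun n => max (Cs n) 0, fun n => le_max_right _ _, fun n σ hσ hσ₁ y => ?_, fun n hn => ?_⟩
  · exact (hCs n σ hσ hσ₁ y).trans (mul_le_mul_of_nonneg_right (le_max_left _ _) (by positivity))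
  · have h0 : 0 ≤ max (Cs 0) 0 := le_max_right _ _
    have h1 : 0 ≤ max (Cs 1) 0 := le_max_right _ _
    have h2 : 0 ≤ max (Cs 2) 0 := le_max_right _ _
    have h3 : 0 ≤ max (Cs 3) 0 := le_max_right _ _
    interval_cases n <;> simp only <;> linarith

/-- Choice of the common law-of-state constant `cZ` and of the packing threshold `ηs`. [folklore] -/
theorem lbClose_eta_choice :
    ∀ (η η₂ η₃ cZ₁ cZ₂ : ℝ), 0 < η → 0 < η₂ → 0 < η₃ → 0 ≤ cZ₁ → 0 ≤ cZ₂ →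
      ∃ cZ ηs : ℝ, cZ₁ ≤ cZ ∧ cZ₂ ≤ cZ ∧ 0 ≤ cZ ∧ 0 < ηs ∧ ηs ≤ η ∧ 2 * ηs ≤ η₂ ∧ 2 * ηs ≤ η₃ ∧
        ηs ≤ 1 / (8 * (cZ + 1)) ∧ cZ * ηs ≤ 1 / 8 := by
  intro η η₂ η₃ cZ₁ cZ₂ hη hη₂ hη₃ h1 h2
  set cZ : ℝ := max cZ₁ cZ₂ with hcZ
  have hcZ0 : 0 ≤ cZ := h1.trans (le_max_left _ _)
  set ηs : ℝ := min η (min (min η₂ η₃ / 2) (1 / (8 * (cZ + 1)))) with hηs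
  have hηs0 : 0 < ηs := lt_min hη (lt_min (half_pos (lt_min hη₂ hη₃)) (by positivity))
  have hA : ηs ≤ min η₂ η₃ / 2 := (min_le_right _ _).trans (min_le_left _ _)
  have hB : ηs ≤ 1 / (8 * (cZ + 1)) := (min_le_right _ _).trans (min_le_right _ _)
  refine ⟨cZ, ηs, le_max_left _ _, le_max_right _ _, hcZ0, hηs0, min_le_left _ _,
    by linarith [min_le_left η₂ η₃], by linarith [min_le_right η₂ η₃], hB, ?_⟩
  calc cZ * ηs ≤ cZ * (1 / (8 * (cZ + 1))) := mul_le_mul_of_nonneg_left hB hcZ0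
    _ = cZ / (cZ + 1) / 8 := by field_simp
    _ ≤ 1 / 8 := by
        have : cZ / (cZ + 1) ≤ 1 := (div_le_one (by positivity)).2 (by linarith)
        linarith

/-! ### The law of state along a solution of small packing -/

/-- From the packing-proportional bounds of the rescaled law (`hsEos_rescaled_bounds`, orders `≤ 2`, and
`hsEos_rescaled_bounds_higher`, orders `3, 4`) and a packing bound `ρσ³ ≤ 2ηs ≤ η₂, η₃` on `[0, T)`:
the three bounds of `ShadowSetting` and `ShadowEosHigher`, with the common constant `cZ`. [folklore] -/
theorem lbClose_eos_along :
    ∀ {σ T η₂ η₃ ηs cZ₁ cZ₂ cZ : ℝ} {ρ : ℝ → T3 → ℝ} {ζ : ℝ → ℝ},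
      (∀ r : ℝ, 0 ≤ r → r * σ ^ 3 ≤ η₂ → |ζ r - 1| ≤ cZ₁ * (r * σ ^ 3) ∧
        |r * deriv ζ r| ≤ cZ₁ * (r * σ ^ 3) ∧ |r ^ 2 * deriv (deriv ζ) r| ≤ cZ₁ * (r * σ ^ 3)) →
      (∀ r : ℝ, 0 ≤ r → r * σ ^ 3 ≤ η₃ → |r ^ 3 * deriv (deriv (deriv ζ)) r| ≤ cZ₂ * (r * σ ^ 3) ∧
        |r ^ 4 * deriv (deriv (deriv (deriv ζ))) r| ≤ cZ₂ * (r * σ ^ 3)) →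
      cZ₁ ≤ cZ → cZ₂ ≤ cZ → 2 * ηs ≤ η₂ → 2 * ηs ≤ η₃ → 0 ≤ σ →
      (∀ t ∈ Ico 0 T, ∀ x, 0 < ρ t x ∧ ρ t x * σ ^ 3 ≤ 2 * ηs) →
      (∀ t ∈ Ico 0 T, ∀ x, |ζ (ρ t x) - 1| ≤ cZ * (ρ t x * σ ^ 3) ∧
        |ρ t x * deriv ζ (ρ t x)| ≤ cZ * (ρ t x * σ ^ 3) ∧
        |ρ t x ^ 2 * deriv (deriv ζ) (ρ t x)| ≤ cZ * (ρ t x * σ ^ 3)) ∧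
      ShadowEosHigher cZ σ T ρ ζ := by
  intro σ T η₂ η₃ ηs cZ₁ cZ₂ cZ ρ ζ h1 h2 hc1 hc2 hη₂ hη₃ hσ hpack
  refine ⟨fun t ht x => ?_, fun t ht x => ?_⟩
  · obtain ⟨hρ, hp⟩ := hpack t ht x
    have hm : cZ₁ * (ρ t x * σ ^ 3) ≤ cZ * (ρ t x * σ ^ 3) :=
      mul_le_mul_of_nonneg_right hc1 (by positivity)
    obtain ⟨a, b, c⟩ := h1 (ρ t x) hρ.le (hp.trans hη₂)
    exact ⟨a.trans hm, b.trans hm, c.trans hm⟩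
  · obtain ⟨hρ, hp⟩ := hpack t ht x
    have hm : cZ₂ * (ρ t x * σ ^ 3) ≤ cZ * (ρ t x * σ ^ 3) :=
      mul_le_mul_of_nonneg_right hc2 (by positivity)
    obtain ⟨a, b⟩ := h2 (ρ t x) hρ.le (hp.trans hη₃)
    exact ⟨a.trans hm, b.trans hm⟩

/-! ### Level bounds at a time, and STRONG ⇒ WEAK -/

/-- `√(a + b) ≤ √a + √b` for all reals. [folklore] -/
theorem lbClose_sqrt_add_le (a b : ℝ) : Real.sqrt (a + b) ≤ Real.sqrt a + Real.sqrt b := by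
  refine Real.sqrt_le_iff.2 ⟨by positivity, ?_⟩
  have ha : a ≤ Real.sqrt a ^ 2 := by rw [Real.sq_sqrt']; exact le_max_left _ _
  have hb : b ≤ Real.sqrt b ^ 2 := by rw [Real.sq_sqrt']; exact le_max_left _ _
  nlinarith [Real.sqrt_nonneg a, Real.sqrt_nonneg b]

/-- **The four level bounds at a time `s ∈ [0, t]`**: `E_k(s) ≤ (σ³ Q̂ X^q)²` (`k ≤ 3`) and
`√(E₂ + E₃)(s) ≤ σ³ Q_B X^{b_B}`, `X = T₁/(T₁ - s) ≥ 1`. [folklore] -/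
theorem lbClose_levels_at :
    ∀ {E0 E1 E2 E3 : ℝ → ℝ} {Q₀ b₀ Q₁ b₁ Q₂ b₂ Q₃ b₃ Qh QB bB q T₁ σ t s : ℝ},
      ShadowLevelBound E0 Q₀ b₀ T₁ σ t → ShadowLevelBound E1 Q₁ b₁ T₁ σ t →
      ShadowLevelBound E2 Q₂ b₂ T₁ σ t → ShadowLevelBound E3 Q₃ b₃ T₁ σ t → s ∈ Icc 0 t → 0 ≤ σ →
      1 ≤ T₁ / (T₁ - s) → 0 ≤ Q₀ → 0 ≤ Q₁ → 0 ≤ Q₂ → 0 ≤ Q₃ → Q₀ + Q₁ + Q₂ + Q₃ ≤ Qh → Q₂ + Q₃ ≤ QB →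
      b₀ ≤ q → b₁ ≤ q → b₂ ≤ q → b₃ ≤ q → b₂ ≤ bB → b₃ ≤ bB →
      E0 s ≤ (σ ^ 3 * Qh * (T₁ / (T₁ - s)) ^ q) ^ 2 ∧ E1 s ≤ (σ ^ 3 * Qh * (T₁ / (T₁ - s)) ^ q) ^ 2 ∧
        E2 s ≤ (σ ^ 3 * Qh * (T₁ / (T₁ - s)) ^ q) ^ 2 ∧ E3 s ≤ (σ ^ 3 * Qh * (T₁ / (T₁ - s)) ^ q) ^ 2 ∧
        Real.sqrt (E2 s + E3 s) ≤ σ ^ 3 * QB * (T₁ / (T₁ - s)) ^ bB := by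
  intro E0 E1 E2 E3 Q₀ b₀ Q₁ b₁ Q₂ b₂ Q₃ b₃ Qh QB bB q T₁ σ t s h0 h1 h2 h3 hs hσ hX hQ₀ hQ₁ hQ₂ hQ₃ hQh
    hQB hb₀ hb₁ hb₂ hb₃ hb₂' hb₃'
  set X : ℝ := T₁ / (T₁ - s) with hX_def
  have hσ3 : 0 ≤ σ ^ 3 := by positivity
  have hXp : ∀ p : ℝ, 0 ≤ X ^ p := fun p => Real.rpow_nonneg (zero_le_one.trans hX) p
  have up : ∀ {E : ℝ → ℝ} {Q b : ℝ}, ShadowLevelBound E Q b T₁ σ t → 0 ≤ Q → Q ≤ Qh → b ≤ q →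
      E s ≤ (σ ^ 3 * Qh * X ^ q) ^ 2 ∧ Real.sqrt (E s) ≤ σ ^ 3 * Q * X ^ b := by
    intro E Q b h hQ hQQ hbq
    have h' : Real.sqrt (E s) ≤ σ ^ 3 * Q * X ^ b := h s hs
    have hm : σ ^ 3 * Q * X ^ b ≤ σ ^ 3 * Qh * X ^ q :=
      mul_le_mul (mul_le_mul_of_nonneg_left hQQ hσ3) (Real.rpow_le_rpow_of_exponent_le hX hbq)
        (hXp b) (mul_nonneg hσ3 (hQ.trans hQQ))
    exact ⟨(Real.sqrt_le_iff.1 (h'.trans hm)).2, h'⟩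
  obtain ⟨e0, -⟩ := up h0 hQ₀ (by linarith) hb₀
  obtain ⟨e1, -⟩ := up h1 hQ₁ (by linarith) hb₁
  obtain ⟨e2, r2⟩ := up h2 hQ₂ (by linarith) hb₂
  obtain ⟨e3, r3⟩ := up h3 hQ₃ (by linarith) hb₃
  refine ⟨e0, e1, e2, e3, ?_⟩
  have r2' : Real.sqrt (E2 s) ≤ σ ^ 3 * Q₂ * X ^ bB :=
    r2.trans (mul_le_mul_of_nonneg_left (Real.rpow_le_rpow_of_exponent_le hX hb₂') (by positivity))
  have r3' : Real.sqrt (E3 s) ≤ σ ^ 3 * Q₃ * X ^ bB :=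
    r3.trans (mul_le_mul_of_nonneg_left (Real.rpow_le_rpow_of_exponent_le hX hb₃') (by positivity))
  calc Real.sqrt (E2 s + E3 s) ≤ Real.sqrt (E2 s) + Real.sqrt (E3 s) := lbClose_sqrt_add_le _ _
    _ ≤ σ ^ 3 * Q₂ * X ^ bB + σ ^ 3 * Q₃ * X ^ bB := add_le_add r2' r3'
    _ = σ ^ 3 * (Q₂ + Q₃) * X ^ bB := by ring
    _ ≤ σ ^ 3 * QB * X ^ bB :=
        mul_le_mul_of_nonneg_right (mul_le_mul_of_nonneg_left hQB hσ3) (hXp bB)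

/-- **STRONG ⇒ WEAK.** The strong bounds on `[0, T)` give `ShadowWeakBootstrap 1 ηs` and (B2) on every
`[0, t]`, `t < T`. [folklore] -/
theorem lbClose_weak_of_strong :
    ∀ {σ T T₁ ηs QB bB : ℝ} {ρ θ ρ₁ θ₁ : ℝ → T3 → ℝ} {u u₁ : ℝ → T3 → V3} {E2 E3 : ℝ → ℝ},
      0 ≤ ηs → 0 ≤ σ ^ 3 * QB → T ≤ T₁ → (∀ t ∈ Ico 0 T, ∀ x, 0 < ρ₁ t x) →
      (∀ t ∈ Ico 0 T, ∀ x, 0 < θ₁ t x) →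
      (∀ t ∈ Ico 0 T, (∀ x, |ρ t x - ρ₁ t x| ≤ ρ₁ t x / 4 ∧ |θ t x - θ₁ t x| ≤ θ₁ t x / 4 ∧
            ρ t x * σ ^ 3 ≤ ηs / 2 ∧
            ∀ i : Fin 3,
              ‖Torus.partialDeriv i (u t) x - Torus.partialDeriv i (u₁ t) x‖ ≤ 1 / (2 * (T₁ - t)) ∧
              Real.sqrt (θ₁ t x) * |Torus.partialDeriv i (ρ t) x - Torus.partialDeriv i (ρ₁ t) x| /
                  ρ₁ t x ≤ 1 / (2 * (T₁ - t)) ∧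
              |Torus.partialDeriv i (θ t) x - Torus.partialDeriv i (θ₁ t) x| / Real.sqrt (θ₁ t x) ≤
                1 / (2 * (T₁ - t))) ∧
          Real.sqrt (E2 t + E3 t) ≤ σ ^ 3 * QB * (T₁ / (T₁ - t)) ^ bB) →
      ∀ t ∈ Ico 0 T, ShadowWeakBootstrap 1 ηs T₁ σ ρ θ u ρ₁ θ₁ u₁ t ∧
        ∀ s ∈ Icc 0 t, Real.sqrt (E2 s + E3 s) ≤ 2 * (σ ^ 3 * QB * (T₁ / (T₁ - s)) ^ bB) := by
  intro σ T T₁ ηs QB bB ρ θ ρ₁ θ₁ u u₁ E2 E3 hηs hQ hTT₁ hρ₁ hθ₁ hS t ht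
  have hts : ∀ s ∈ Icc 0 t, s ∈ Ico 0 T := fun s hs => ⟨hs.1, hs.2.trans_lt ht.2⟩
  have hl : ∀ s ∈ Icc 0 t, 0 < T₁ - s := fun s hs => by linarith [(hts s hs).2]
  have hhalf : ∀ s ∈ Icc 0 t, 1 / (2 * (T₁ - s)) ≤ 1 / (T₁ - s) := fun s hs =>
    one_div_le_one_div_of_le (hl s hs) (by linarith [hl s hs])
  refine ⟨⟨fun s hs x => ?_, fun s hs x i => ?_⟩, fun s hs => ?_⟩
  · obtain ⟨a, b, c, -⟩ := (hS s (hts s hs)).1 x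
    have := hρ₁ s (hts s hs) x
    have := hθ₁ s (hts s hs) x
    exact ⟨a.trans (by linarith), b.trans (by linarith), c.trans (by linarith)⟩
  · obtain ⟨a, b, c⟩ := ((hS s (hts s hs)).1 x).2.2.2 i
    exact ⟨a.trans (hhalf s hs), b.trans (hhalf s hs), c.trans (hhalf s hs)⟩
  · have h := (hS s (hts s hs)).2
    have h0 : 0 ≤ σ ^ 3 * QB * (T₁ / (T₁ - s)) ^ bB :=
      mul_nonneg hQ (Real.rpow_nonneg (div_pos (by linarith [hl s hs, hs.1]) (hl s hs)).le _)
    linarith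

end Summit.AtomisticToContinuum.HydrodynamicLimit.Theorems

end
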